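import Summits.AtomisticToContinuum.HydrodynamicLimit.Theorems.LambertianContactSwapLambertianEulerCellChargingPath
import HarnessLib

/-!
# Cellwise fresh / non-fresh charging of the Lambertian collision sequence
# (`LambertianContactSwap.LambertianEuler`, stmt-AtomisticToContinuum-11854, line `Sketch`; lead c10,
# piece W7 `CellCharging`, part 4 of 4: the deliverable `windowCount_le_cellShells_add_marks`;
# registered helper stub `norm_sepVec_translate_le`)

Pathwise (deterministic, no measure theory) device reducing the upper tail of the window collision
count of the Lambertian gas to single-time statics plus marked collisions.  Notation (as in
`…MarkedKorolyuk`, `…CellChargingFlight`): `t_k = lambertInstant`, `K_s = lambertCount`,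
`z_k = lambertStateAfter`, `τ_k = freeExitTime z_k`, `Λ_s = lambertFlow`, `z_k♭ = S_{τ_k} z_k` the exit
configuration of collision number `k + 1` (time `t_{k+1}`), `p_k` its unique incoming pair on a path
with simple incoming exits, `z_{k+1} = lambertPair p_k z_k♭ (ξs k)`.  The velocity SHELL of width `δ`
of a pair `(i, j)` of a configuration `y` is `ε ≤ d(y_i, y_j) ≤ ε + δ ‖v_i - v_j‖`; a counted collision
`m` is MARKED (threshold `L`) if at `z_m♭` a third particle lies in the `δ`-shell of one of the two
colliding particles, or the colliding pair is fast, `L ≤ δ ‖Δv‖`.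

* `windowCount_le_cellShells_add_marks` (the deliverable, torus `𝕋³`, diameter `hsDiameter σ N`):
  on a simple (`τ_k > 0`), non-accumulating path with simple incoming exits, for cells
  `(a' + jδ, a' + (j+1)δ]`, `j < J`,
  `K_{a'+Jδ} - K_{a'} ≤ Σ_{j<J} #{ordered shell pairs of Λ_{a'+jδ}} + 3 · #{marked counted collisions}`,
  given the "no fast re-collision" hypothesis: two particles at contact, not incoming, flying freely
  for `u ∈ (0, δ]` to contact and incoming have `L ≤ δ ‖Δv‖` (on `𝕋³` this is
  `…TorusNoFastRecollision.one_sub_two_mul_le_mul_norm_of_recontact`, `L = 1 - 2ε`).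
  It is `…CellChargingPath.windowCount_le_of_noRecollision` in the torus geometry, whose separation is
  Lipschitz along translations (`norm_sepVec_translate_le`,
  `norm_sepVec_le_norm_sepVec_translate_add`) and symmetric (`Torus.euclidDist_comm`), with the mark
  `𝟙{(∃ r ≠ q.1, q.2, third particle in a δ-shell of q.1 or q.2) ∨ L ≤ δ ‖Δv_q‖}`.

Proof of the pathwise inequality (`…CellChargingPath`, with `…CellChargingCount`,
`…CellChargingFlight`).  The counted collisions
are `k₁ ≤ m < K` (`k₁ = K_{a'}`, `K = K_{a'+Jδ}`); the cell of `m` is `⌈(t_{m+1} - a')/δ⌉ - 1 < J`,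
nondecreasing in `m`.  A collision is FRESH if no earlier collision of its cell involves one of its two
particles.  (A) For fresh `m` with cell start `s = a' + jδ` both particles of `p_m` flew freely from
`Λ_s` for the time `t_{m+1} - s ∈ (0, δ]` to contact, so `p_m` is a shell pair of `Λ_s`;
`m ↦ (cell, p_m)` is injective on fresh collisions.  (B) For non-fresh `m`, a particle `a ∈ p_m`
collided last (in the cell) at `m'` with partner `b`; (B1) if `b` is free since: either `b ∉ p_m` is
a third particle in the `δ`-shell of `a` at `z_m♭`, or `p_m = p_{m'}` re-collides within `δ`, a fast
pair — `m` is marked; (B2) else `b` collides first again at `m'' < m` without `a`, and `a` is a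
third particle in the `δ`-shell of `b` at `z_{m''}♭` — `m''` is marked, and `m` is recovered from
`m''` and the choice of `b ∈ p_{m''}`, so at most `3` non-fresh collisions are charged to a marked one.

References: C. Cercignani, R. Illner, M. Pulvirenti, *The Mathematical Theory of Dilute Gases*
(1994), App. 4.A; Gallagher–Saint-Raymond–Texier 2013, Ch. 4; Daley–Vere-Jones I, §3.3.
All statements [folklore].
-/

noncomputable section

namespace Summit.AtomisticToContinuum.HydrodynamicLimit.Theorems.LambertianContactSwapLambertianEulerCellCharging

open scoped BigOperators Topology ENNReal InnerProductSpace
open MeasureTheory Filter Set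
open Literature.MathematicalPhysics.KineticTheory
open Literature.Analysis.FluidPDE Literature.Analysis.FluidPDE.Alexander
open Summit.AtomisticToContinuum.HydrodynamicLimit.Theorems.LambertianContactSwapLambertianEulerCellChargingPath

/-! ## The torus separation is Lipschitz along translations -/

/-- On the flat torus the minimal-image separation vector is `1`-Lipschitz along translations:
`‖sep(x + u vx, y + u vy)‖ ≤ ‖sep(x, y)‖ + |u| ‖vx - vy‖` (`Torus.euclidDist_translate_le`; registered
helper stub of lead c10's piece W7, part 4). [folklore] -/
theorem norm_sepVec_translate_le :
    ∀ (x y : T3) (vx vy : V3) (u : ℝ),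
      ‖(Torus.geometry (Fin 3)).sepVec ((Torus.geometry (Fin 3)).translate x (u • vx))
          ((Torus.geometry (Fin 3)).translate y (u • vy))‖ ≤
        ‖(Torus.geometry (Fin 3)).sepVec x y‖ + |u| * ‖vx - vy‖ := by
  intro x y vx vy u
  have h := Torus.euclidDist_translate_le x y (u • vx) (u • vy)
  rw [← smul_sub, norm_smul, Real.norm_eq_abs] at h
  simpa only [Torus.geometry_translate, Torus.norm_geometry_sepVec] using h

/-- Conversely `‖sep(x, y)‖ ≤ ‖sep(x + u vx, y + u vy)‖ + |u| ‖vx - vy‖` on the flat torus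
(`Torus.euclidDist_le_euclidDist_translate`). [folklore] -/
theorem norm_sepVec_le_norm_sepVec_translate_add :
    ∀ (x y : T3) (vx vy : V3) (u : ℝ),
      ‖(Torus.geometry (Fin 3)).sepVec x y‖ ≤
        ‖(Torus.geometry (Fin 3)).sepVec ((Torus.geometry (Fin 3)).translate x (u • vx))
            ((Torus.geometry (Fin 3)).translate y (u • vy))‖ + |u| * ‖vx - vy‖ := by
  intro x y vx vy u
  have h := Torus.euclidDist_le_euclidDist_translate x y (u • vx) (u • vy)
  rw [← smul_sub, norm_smul, Real.norm_eq_abs] at h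
  simpa only [Torus.geometry_translate, Torus.norm_geometry_sepVec] using h

/-! ## The deliverable: the torus `𝕋³` at fixed reduced density -/

/-- **W7: the pathwise cell charging inequality** (stub
`windowCount_le_cellShells_add_marks` of lead c10, line `Sketch`, crux stmt-AtomisticToContinuum-11854).
On a simple, non-accumulating Lambertian path from the hard-sphere domain of `N + 1` spheres of
diameter `hsDiameter σ N` in `𝕋³` whose exit configurations are simple incoming, for a cell width
`δ > 0`, a fast threshold `L` satisfying the "no fast re-collision within time `δ`" property of the
torus, `a' ≥ 0` and `J` cells: `K_{a'+Jδ} - K_{a'}` is at most the sum over the cell starts `a' + jδ`,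
`j < J`, of the number of ordered shell pairs `ε ≤ d_q(Λ_{a'+jδ}) ≤ ε + δ ‖Δv_q‖`, plus three times the
number of counted collisions carrying the mark (a third particle in the `δ`-shell of a colliding
particle at the exit configuration, or a fast colliding pair `L ≤ δ ‖Δv‖`)
(`windowCount_le_of_noRecollision` with the torus Lipschitz bounds `norm_sepVec_translate_le`,
`norm_sepVec_le_norm_sepVec_translate_add` and `Torus.euclidDist_comm`). [folklore] -/
theorem windowCount_le_cellShells_add_marks :
    ∀ {σ : ℝ}, 0 < σ → σ < 2⁻¹ → ∀ (N : ℕ) (z : Config (N + 1) (Fin 3) T3) (ξs : ℕ → V3),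
      z ∈ hardSphereDomain (Torus.geometry (Fin 3)) (N + 1) (hsDiameter σ N) →
      (∀ k : ℕ, 0 < freeExitTime (Torus.geometry (Fin 3)) (hsDiameter σ N)
          (lambertStateAfter (Torus.geometry (Fin 3)) (hsDiameter σ N) ξs z k)) →
      (∀ T : ℝ, ∃ k, ENNReal.ofReal T < lambertInstant (Torus.geometry (Fin 3)) (hsDiameter σ N) ξs z k) →
      (∀ k : ℕ, freeExitTime (Torus.geometry (Fin 3)) (hsDiameter σ N)
            (lambertStateAfter (Torus.geometry (Fin 3)) (hsDiameter σ N) ξs z k) ≠ ⊤ →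
          IsSimpleIncoming (Torus.geometry (Fin 3)) (hsDiameter σ N)
            (freeFlight (Torus.geometry (Fin 3))
              (freeExitTime (Torus.geometry (Fin 3)) (hsDiameter σ N)
                (lambertStateAfter (Torus.geometry (Fin 3)) (hsDiameter σ N) ξs z k)).toReal
              (lambertStateAfter (Torus.geometry (Fin 3)) (hsDiameter σ N) ξs z k))) →
      ∀ (δ L : ℝ), 0 < δ →
        (∀ (x y : T3) (vx vy : V3) (u : ℝ), 0 < u → u ≤ δ →
            ‖(Torus.geometry (Fin 3)).sepVec x y‖ = hsDiameter σ N →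
            0 ≤ ⟪(Torus.geometry (Fin 3)).sepVec x y, vx - vy⟫_ℝ →
            ‖(Torus.geometry (Fin 3)).sepVec ((Torus.geometry (Fin 3)).translate x (u • vx))
                ((Torus.geometry (Fin 3)).translate y (u • vy))‖ = hsDiameter σ N →
            ⟪(Torus.geometry (Fin 3)).sepVec ((Torus.geometry (Fin 3)).translate x (u • vx))
                ((Torus.geometry (Fin 3)).translate y (u • vy)), vx - vy⟫_ℝ < 0 →
            L ≤ δ * ‖vx - vy‖) →
        ∀ a' : ℝ, 0 ≤ a' → ∀ J : ℕ,
          ((lambertCount (Torus.geometry (Fin 3)) (hsDiameter σ N) ξs z (a' + (J : ℝ) * δ) : ℕ) : ℝ) -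
              ((lambertCount (Torus.geometry (Fin 3)) (hsDiameter σ N) ξs z a' : ℕ) : ℝ) ≤
            (∑ j ∈ Finset.range J, ∑ q : Fin (N + 1) × Fin (N + 1),
                if q.1 ≠ q.2 ∧
                    hsDiameter σ N ≤ ‖(Torus.geometry (Fin 3)).sepVec
                      (lambertFlow (Torus.geometry (Fin 3)) (hsDiameter σ N) ξs z (a' + (j : ℝ) * δ) q.1).1
                      (lambertFlow (Torus.geometry (Fin 3)) (hsDiameter σ N) ξs z (a' + (j : ℝ) * δ) q.2).1‖ ∧
                    ‖(Torus.geometry (Fin 3)).sepVec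
                      (lambertFlow (Torus.geometry (Fin 3)) (hsDiameter σ N) ξs z (a' + (j : ℝ) * δ) q.1).1
                      (lambertFlow (Torus.geometry (Fin 3)) (hsDiameter σ N) ξs z (a' + (j : ℝ) * δ) q.2).1‖ ≤
                      hsDiameter σ N + δ *
                        ‖(lambertFlow (Torus.geometry (Fin 3)) (hsDiameter σ N) ξs z (a' + (j : ℝ) * δ) q.1).2 -
                          (lambertFlow (Torus.geometry (Fin 3)) (hsDiameter σ N) ξs z (a' + (j : ℝ) * δ) q.2).2‖
                  then (1 : ℝ) else 0) +
            3 * ∑ m ∈ Finset.range (lambertCount (Torus.geometry (Fin 3)) (hsDiameter σ N) ξs z (a' + (J : ℝ) * δ)),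
                if a' < (lambertInstant (Torus.geometry (Fin 3)) (hsDiameter σ N) ξs z (m + 1)).toReal then
                  ∑ q : Fin (N + 1) × Fin (N + 1),
                    (incomingPairs (Torus.geometry (Fin 3)) (hsDiameter σ N)
                      (freeFlight (Torus.geometry (Fin 3))
                        (freeExitTime (Torus.geometry (Fin 3)) (hsDiameter σ N)
                          (lambertStateAfter (Torus.geometry (Fin 3)) (hsDiameter σ N) ξs z m)).toReal
                        (lambertStateAfter (Torus.geometry (Fin 3)) (hsDiameter σ N) ξs z m))).indicator
                      (fun q' => if (∃ r : Fin (N + 1), r ≠ q'.1 ∧ r ≠ q'.2 ∧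
                          ((hsDiameter σ N ≤ ‖(Torus.geometry (Fin 3)).sepVec
                              (freeFlight (Torus.geometry (Fin 3)) (freeExitTime (Torus.geometry (Fin 3)) (hsDiameter σ N)
                                (lambertStateAfter (Torus.geometry (Fin 3)) (hsDiameter σ N) ξs z m)).toReal
                                (lambertStateAfter (Torus.geometry (Fin 3)) (hsDiameter σ N) ξs z m) q'.1).1
                              (freeFlight (Torus.geometry (Fin 3)) (freeExitTime (Torus.geometry (Fin 3)) (hsDiameter σ N)
                                (lambertStateAfter (Torus.geometry (Fin 3)) (hsDiameter σ N) ξs z m)).toReal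
                                (lambertStateAfter (Torus.geometry (Fin 3)) (hsDiameter σ N) ξs z m) r).1‖ ∧
                            ‖(Torus.geometry (Fin 3)).sepVec
                              (freeFlight (Torus.geometry (Fin 3)) (freeExitTime (Torus.geometry (Fin 3)) (hsDiameter σ N)
                                (lambertStateAfter (Torus.geometry (Fin 3)) (hsDiameter σ N) ξs z m)).toReal
                                (lambertStateAfter (Torus.geometry (Fin 3)) (hsDiameter σ N) ξs z m) q'.1).1
                              (freeFlight (Torus.geometry (Fin 3)) (freeExitTime (Torus.geometry (Fin 3)) (hsDiameter σ N)
                                (lambertStateAfter (Torus.geometry (Fin 3)) (hsDiameter σ N) ξs z m)).toReal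
                                (lambertStateAfter (Torus.geometry (Fin 3)) (hsDiameter σ N) ξs z m) r).1‖ ≤
                              hsDiameter σ N + δ *
                                ‖(freeFlight (Torus.geometry (Fin 3)) (freeExitTime (Torus.geometry (Fin 3)) (hsDiameter σ N)
                                  (lambertStateAfter (Torus.geometry (Fin 3)) (hsDiameter σ N) ξs z m)).toReal
                                  (lambertStateAfter (Torus.geometry (Fin 3)) (hsDiameter σ N) ξs z m) q'.1).2 -
                                  (freeFlight (Torus.geometry (Fin 3)) (freeExitTime (Torus.geometry (Fin 3)) (hsDiameter σ N)
                                    (lambertStateAfter (Torus.geometry (Fin 3)) (hsDiameter σ N) ξs z m)).toReal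
                                    (lambertStateAfter (Torus.geometry (Fin 3)) (hsDiameter σ N) ξs z m) r).2‖) ∨
                           (hsDiameter σ N ≤ ‖(Torus.geometry (Fin 3)).sepVec
                              (freeFlight (Torus.geometry (Fin 3)) (freeExitTime (Torus.geometry (Fin 3)) (hsDiameter σ N)
                                (lambertStateAfter (Torus.geometry (Fin 3)) (hsDiameter σ N) ξs z m)).toReal
                                (lambertStateAfter (Torus.geometry (Fin 3)) (hsDiameter σ N) ξs z m) q'.2).1
                              (freeFlight (Torus.geometry (Fin 3)) (freeExitTime (Torus.geometry (Fin 3)) (hsDiameter σ N)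
                                (lambertStateAfter (Torus.geometry (Fin 3)) (hsDiameter σ N) ξs z m)).toReal
                                (lambertStateAfter (Torus.geometry (Fin 3)) (hsDiameter σ N) ξs z m) r).1‖ ∧
                            ‖(Torus.geometry (Fin 3)).sepVec
                              (freeFlight (Torus.geometry (Fin 3)) (freeExitTime (Torus.geometry (Fin 3)) (hsDiameter σ N)
                                (lambertStateAfter (Torus.geometry (Fin 3)) (hsDiameter σ N) ξs z m)).toReal
                                (lambertStateAfter (Torus.geometry (Fin 3)) (hsDiameter σ N) ξs z m) q'.2).1
                              (freeFlight (Torus.geometry (Fin 3)) (freeExitTime (Torus.geometry (Fin 3)) (hsDiameter σ N)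
                                (lambertStateAfter (Torus.geometry (Fin 3)) (hsDiameter σ N) ξs z m)).toReal
                                (lambertStateAfter (Torus.geometry (Fin 3)) (hsDiameter σ N) ξs z m) r).1‖ ≤
                              hsDiameter σ N + δ *
                                ‖(freeFlight (Torus.geometry (Fin 3)) (freeExitTime (Torus.geometry (Fin 3)) (hsDiameter σ N)
                                  (lambertStateAfter (Torus.geometry (Fin 3)) (hsDiameter σ N) ξs z m)).toReal
                                  (lambertStateAfter (Torus.geometry (Fin 3)) (hsDiameter σ N) ξs z m) q'.2).2 -
                                  (freeFlight (Torus.geometry (Fin 3)) (freeExitTime (Torus.geometry (Fin 3)) (hsDiameter σ N)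
                                    (lambertStateAfter (Torus.geometry (Fin 3)) (hsDiameter σ N) ξs z m)).toReal
                                    (lambertStateAfter (Torus.geometry (Fin 3)) (hsDiameter σ N) ξs z m) r).2‖))) ∨
                          L ≤ δ * ‖(freeFlight (Torus.geometry (Fin 3)) (freeExitTime (Torus.geometry (Fin 3)) (hsDiameter σ N)
                              (lambertStateAfter (Torus.geometry (Fin 3)) (hsDiameter σ N) ξs z m)).toReal
                              (lambertStateAfter (Torus.geometry (Fin 3)) (hsDiameter σ N) ξs z m) q'.1).2 -
                            (freeFlight (Torus.geometry (Fin 3)) (freeExitTime (Torus.geometry (Fin 3)) (hsDiameter σ N)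
                              (lambertStateAfter (Torus.geometry (Fin 3)) (hsDiameter σ N) ξs z m)).toReal
                              (lambertStateAfter (Torus.geometry (Fin 3)) (hsDiameter σ N) ξs z m) q'.2).2‖
                        then (1 : ℝ) else 0) q
                else 0 := by
  intro σ _ _ N z ξs _ hpos hacc hsimple δ L hδ hL a' ha' J
  refine windowCount_le_of_noRecollision (G := Torus.geometry (Fin 3)) (ε := hsDiameter σ N)
    norm_sepVec_le_norm_sepVec_translate_add norm_sepVec_translate_le
    (fun x y => Torus.euclidDist_comm x y) hpos hacc hsimple hδ hL
    (fun q' y => if (∃ r : Fin (N + 1), r ≠ q'.1 ∧ r ≠ q'.2 ∧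
        ((hsDiameter σ N ≤ ‖(Torus.geometry (Fin 3)).sepVec (y q'.1).1 (y r).1‖ ∧
            ‖(Torus.geometry (Fin 3)).sepVec (y q'.1).1 (y r).1‖ ≤
              hsDiameter σ N + δ * ‖(y q'.1).2 - (y r).2‖) ∨
          (hsDiameter σ N ≤ ‖(Torus.geometry (Fin 3)).sepVec (y q'.2).1 (y r).1‖ ∧
            ‖(Torus.geometry (Fin 3)).sepVec (y q'.2).1 (y r).1‖ ≤
              hsDiameter σ N + δ * ‖(y q'.2).2 - (y r).2‖))) ∨
        L ≤ δ * ‖(y q'.1).2 - (y q'.2).2‖ then (1 : ℝ) else 0)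
    (fun q y => ?_) (fun q y r h1 h2 h3 => ?_) (fun q y h => ?_) ha' J
  · split_ifs <;> norm_num
  · rw [if_pos (Or.inl ⟨r, h1, h2, h3⟩)]
  · rw [if_pos (Or.inr h)]

end Summit.AtomisticToContinuum.HydrodynamicLimit.Theorems.LambertianContactSwapLambertianEulerCellCharging

end
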